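import Summits.Ventures.PercRepro.S2BasesTriangles
import Summits.Ventures.PercRepro.S2CobasisDisjoint
import Summits.Ventures.PercRepro.S2PaymentTop

/-!
# PercRepro — S2: THE COBASIS CHARGE OF THE `6`-SETS AT CORANK `6` (p7, gen 12; sub-claim S2; the cell `(15, 6)`)

At corank `6` a top `6`-set `B` (`ρ(B) = 5`, `E ∖ B` spanning) is a COBASIS with exactly one circuit inside. Through a circuit `C`
the top `6`-sets number at most `C(n − |C|, 6 − |C|)` (the kit's charge); through a TRIANGLE `T` they are the bases of `M` inside
`E ∖ T`, and once some circuit `C′` of `≤ 4` points avoids `T` (g6's Lemma A gives one for every triangle when `s₃ ≥ 5`), the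
`p`-subsets of `E ∖ T` through `C′` are dependent: **`ncard_cobases_through_add_le`** —
  `#{B : |B| = d, T ⊆ B, E ∖ B spanning} + C(n − |T| − |C′|, p − |C′|) ≤ C(n − |T|, p)`
(at `(15, 6)`: `≤ C(18, 15) − C(14, 11) = 452` against the kit's `816`). **`ncard_top_six_le`**: every top `6`-set contains a circuit of
`3 … 6` points, so `#{top 6-sets} ≤ s₃·t + s₄·C(n − 4, 2) + s₅·(n − 5) + s₆` for any per-triangle bound `t`. Axioms: standard.
-/

open scoped Matroid

namespace PercRepro

namespace S2

open Set

variable {α : Type}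

/-- **The `p`-subsets of a finite set `Z` through `U ⊆ Z`, from below**: at least `C(|Z| − |U|, p − |U|)` of them. -/
theorem choose_le_ncard_subsets_superset' (Z : Set α) (hZ : Z.Finite) {U : Set α} (hU : U ⊆ Z) (p : ℕ)
    (hup : U.ncard ≤ p) :
    (Z.ncard - U.ncard).choose (p - U.ncard) ≤ {X : Set α | X ⊆ Z ∧ X.ncard = p ∧ U ⊆ X}.ncard := by
  classical
  have hUfin : U.Finite := hZ.subset hU
  have hmaps : ∀ Y ∈ {Y : Set α | Y ⊆ Z \ U ∧ Y.ncard = p - U.ncard},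
      (fun Y : Set α => Y ∪ U) Y ∈ {X : Set α | X ⊆ Z ∧ X.ncard = p ∧ U ⊆ X} := by
    rintro Y ⟨hYE, hYp⟩
    have hYfin : Y.Finite := (hZ.sdiff).subset hYE
    have hdis : Disjoint Y U := Set.disjoint_of_subset_left hYE Set.disjoint_sdiff_left
    refine ⟨Set.union_subset (hYE.trans Set.sdiff_subset) hU, ?_, Set.subset_union_right⟩
    rw [Set.ncard_union_eq hdis hYfin hUfin, hYp]
    omega
  have hinj : Set.InjOn (fun Y : Set α => Y ∪ U) {Y : Set α | Y ⊆ Z \ U ∧ Y.ncard = p - U.ncard} := by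
    intro Y hY Y' hY' hYY'
    simp only at hYY'
    have hY1 : (Y ∪ U) \ U = Y := by
      rw [Set.union_sdiff_right]
      exact sdiff_eq_self_iff_disjoint.2 (Set.disjoint_of_subset_left hY.1 Set.disjoint_sdiff_left).symm
    have hY2 : (Y' ∪ U) \ U = Y' := by
      rw [Set.union_sdiff_right]
      exact sdiff_eq_self_iff_disjoint.2 (Set.disjoint_of_subset_left hY'.1 Set.disjoint_sdiff_left).symm
    calc Y = (Y ∪ U) \ U := hY1.symm
      _ = (Y' ∪ U) \ U := by rw [hYY']
      _ = Y' := hY2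
  calc (Z.ncard - U.ncard).choose (p - U.ncard)
      = (Z \ U).ncard.choose (p - U.ncard) := by rw [Set.ncard_sdiff hU hUfin]
    _ = {Y : Set α | Y ⊆ Z \ U ∧ Y.ncard = p - U.ncard}.ncard :=
        (ncard_subsets_ncard_eq (Z \ U) (hZ.sdiff) _).symm
    _ ≤ {X : Set α | X ⊆ Z ∧ X.ncard = p ∧ U ⊆ X}.ncard :=
        Set.ncard_le_ncard_of_injOn _ hmaps hinj (hZ.finite_subsets.subset (fun X hX => hX.1))

/-- **The cobases through `T` with a circuit `C′` avoiding `T`**: the `d`-sets `B ⊇ T` with `E ∖ B` spanning are complements of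
bases inside `E ∖ T`, and no basis contains `C′`. -/
theorem ncard_cobases_through_add_le (M : Matroid α) [M.Finite] {p d : ℕ} (hR : M.eRank = (p : ℕ∞))
    (hn : M.E.ncard = p + d) {T C' : Set α} (hT : T ⊆ M.E) (hC' : M.IsCircuit C') (hdis : Disjoint C' T)
    (hc'p : C'.ncard ≤ p) :
    {B : Set α | B ⊆ M.E ∧ B.ncard = d ∧ T ⊆ B ∧ M.eRk (M.E \ B) = M.eRank}.ncard +
      (M.E.ncard - T.ncard - C'.ncard).choose (p - C'.ncard) ≤ (M.E.ncard - T.ncard).choose p := by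
  classical
  have hTfin : T.Finite := M.ground_finite.subset hT
  have hZfin : (M.E \ T).Finite := M.ground_finite.sdiff
  set Sp := {X : Set α | X ⊆ M.E \ T ∧ X.ncard = p ∧ M.eRk X = M.eRank} with hSp
  set Sc := {X : Set α | X ⊆ M.E \ T ∧ X.ncard = p ∧ C' ⊆ X} with hSc
  have hSpfin : Sp.Finite := hZfin.finite_subsets.subset (fun X hX => hX.1)
  have hScfin : Sc.Finite := hZfin.finite_subsets.subset (fun X hX => hX.1)
  -- the complement map into `Sp`
  have hcomp : {B : Set α | B ⊆ M.E ∧ B.ncard = d ∧ T ⊆ B ∧ M.eRk (M.E \ B) = M.eRank}.ncard ≤ Sp.ncard := by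
    have hmaps : ∀ B ∈ {B : Set α | B ⊆ M.E ∧ B.ncard = d ∧ T ⊆ B ∧ M.eRk (M.E \ B) = M.eRank},
        (fun B : Set α => M.E \ B) B ∈ Sp := by
      rintro B ⟨hBE, hBd, hTB, hBs⟩
      refine ⟨Set.sdiff_subset_sdiff_right hTB, ?_, hBs⟩
      rw [Set.ncard_sdiff hBE (M.ground_finite.subset hBE), hn, hBd]
      omega
    have hinj : Set.InjOn (fun B : Set α => M.E \ B)
        {B : Set α | B ⊆ M.E ∧ B.ncard = d ∧ T ⊆ B ∧ M.eRk (M.E \ B) = M.eRank} := by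
      intro X hX Y hY hXY
      simp only at hXY
      rw [← Set.sdiff_sdiff_cancel_left hX.1, hXY, Set.sdiff_sdiff_cancel_left hY.1]
    exact Set.ncard_le_ncard_of_injOn _ hmaps hinj hSpfin
  -- `Sp` and `Sc` are disjoint subsets of the `p`-subsets of `E ∖ T`
  have hdisj : Disjoint Sp Sc := by
    rw [Set.disjoint_left]
    rintro X ⟨hXZ, hXp, hXs⟩ ⟨-, -, hCX⟩
    have hXE : X ⊆ M.E := hXZ.trans Set.sdiff_subset
    have hXfin : X.Finite := M.ground_finite.subset hXE
    have hD : M.Dep X := hC'.dep.superset hCX hXE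
    have hlt := Matroid.eRk_lt_encard_of_dep_of_finite hXfin hD
    rw [hXs, hR, ← hXfin.cast_ncard_eq, hXp] at hlt
    exact lt_irrefl _ hlt
  have hunion : Sp.ncard + Sc.ncard ≤ (M.E.ncard - T.ncard).choose p := by
    rw [← Set.ncard_union_eq hdisj hSpfin hScfin, ← Set.ncard_sdiff hT hTfin,
      ← ncard_subsets_ncard_eq (M.E \ T) hZfin p]
    refine Set.ncard_le_ncard ?_ (hZfin.finite_subsets.subset (fun X hX => hX.1))
    rintro X (hX | hX)
    · exact ⟨hX.1, hX.2.1⟩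
    · exact ⟨hX.1, hX.2.1⟩
  have hC'Z : C' ⊆ M.E \ T := Set.subset_sdiff.2 ⟨hC'.subset_ground, hdis⟩
  have hlow := choose_le_ncard_subsets_superset' (M.E \ T) hZfin hC'Z p hc'p
  rw [Set.ncard_sdiff hT hTfin, ← hSc] at hlow
  omega

/-- **The top `6`-sets through circuits**: every top `6`-set (`|B| = 6`, `ρ(B) = 5`, `E ∖ B` spanning) contains a circuit of
`3 … 6` points; through a triangle at most `t` of them, through a `k`-circuit at most `C(n − k, 6 − k)`. -/
theorem ncard_top_six_le (M : Matroid α) [M.Finite] {p : ℕ} (hn : M.E.ncard = p + 6)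
    (hcirc : ∀ C, M.IsCircuit C → 3 ≤ C.encard) (t : ℕ)
    (htri : ∀ T : Set α, M.IsCircuit T → T.ncard = 3 →
      {B : Set α | B ⊆ M.E ∧ B.ncard = 6 ∧ T ⊆ B ∧ M.eRk (M.E \ B) = M.eRank}.ncard ≤ t) :
    {B : Set α | B ⊆ M.E ∧ B.ncard = 6 ∧ M.eRk B = 5 ∧ M.eRk (M.E \ B) = M.eRank}.ncard ≤
      {C : Set α | M.IsCircuit C ∧ C.ncard = 3}.ncard * t +
      {C : Set α | M.IsCircuit C ∧ C.ncard = 4}.ncard * (p + 6 - 4).choose 2 +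
      {C : Set α | M.IsCircuit C ∧ C.ncard = 5}.ncard * (p + 6 - 5) +
      {C : Set α | M.IsCircuit C ∧ C.ncard = 6}.ncard := by
  classical
  set Top := {B : Set α | B ⊆ M.E ∧ B.ncard = 6 ∧ M.eRk B = 5 ∧ M.eRk (M.E \ B) = M.eRank} with hTop
  let A : ℕ → Set (Set α) := fun k => ⋃ C ∈ Matroid.circF M k,
    {B : Set α | B ⊆ M.E ∧ B.ncard = 6 ∧ C ⊆ B ∧ M.eRk (M.E \ B) = M.eRank}
  -- every top `6`-set contains a circuit of `3 … 6` points
  have hcover : Top ⊆ A 3 ∪ A 4 ∪ A 5 ∪ A 6 := by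
    rintro B ⟨hBE, hB6, hB5, hBs⟩
    have hBfin : B.Finite := M.ground_finite.subset hBE
    have hD : M.Dep B := by
      rw [← Matroid.eRk_lt_encard_iff_dep_of_finite hBfin hBE, hB5, ← hBfin.cast_ncard_eq, hB6]
      norm_num
    obtain ⟨C, hCB, hC⟩ := hD.exists_isCircuit_subset
    have hCfin : C.Finite := hBfin.subset hCB
    have hC3 : 3 ≤ C.ncard := by
      have := hcirc C hC
      rw [← hCfin.cast_ncard_eq] at this
      exact_mod_cast this
    have hC6 : C.ncard ≤ 6 := by
      have := Set.ncard_le_ncard hCB hBfin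
      omega
    have hmem : ∀ k, C.ncard = k → B ∈ A k := by
      intro k hk
      exact Set.mem_iUnion₂.2 ⟨C, Matroid.mem_circF.2 ⟨hC, hk⟩, hBE, hB6, hCB, hBs⟩
    rcases (show C.ncard = 3 ∨ C.ncard = 4 ∨ C.ncard = 5 ∨ C.ncard = 6 by omega) with h | h | h | h
    · exact Or.inl (Or.inl (Or.inl (hmem 3 h)))
    · exact Or.inl (Or.inl (Or.inr (hmem 4 h)))
    · exact Or.inl (Or.inr (hmem 5 h))
    · exact Or.inr (hmem 6 h)
  have hAfin : ∀ k, (A k).Finite := fun k =>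
    M.ground_finite.finite_subsets.subset (fun B hB => by
      obtain ⟨C, -, hB⟩ := Set.mem_iUnion₂.1 hB
      exact hB.1)
  -- each `A k` by the union bound over the `k`-circuits
  have hAk : ∀ k (b : ℕ), (∀ C, M.IsCircuit C → C.ncard = k →
      {B : Set α | B ⊆ M.E ∧ B.ncard = 6 ∧ C ⊆ B ∧ M.eRk (M.E \ B) = M.eRank}.ncard ≤ b) →
      (A k).ncard ≤ {C : Set α | M.IsCircuit C ∧ C.ncard = k}.ncard * b := by
    intro k b hb
    calc (A k).ncard ≤ ∑ C ∈ Matroid.circF M k,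
          {B : Set α | B ⊆ M.E ∧ B.ncard = 6 ∧ C ⊆ B ∧ M.eRk (M.E \ B) = M.eRank}.ncard :=
          Finset.set_ncard_biUnion_le (Matroid.circF M k) _
      _ ≤ ∑ _C ∈ Matroid.circF M k, b := by
          refine Finset.sum_le_sum (fun C hC => ?_)
          obtain ⟨hCc, hCk⟩ := Matroid.mem_circF.1 hC
          exact hb C hCc hCk
      _ = {C : Set α | M.IsCircuit C ∧ C.ncard = k}.ncard * b := by
          rw [Finset.sum_const, smul_eq_mul, Matroid.card_circF]
  have hsup : ∀ k (C : Set α), M.IsCircuit C → C.ncard = k →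
      {B : Set α | B ⊆ M.E ∧ B.ncard = 6 ∧ C ⊆ B ∧ M.eRk (M.E \ B) = M.eRank}.ncard ≤
        (p + 6 - k).choose (6 - k) := by
    intro k C hC hCk
    have h := ncard_subsets_superset_le M hC.subset_ground 6
    rw [hn, hCk] at h
    refine le_trans (Set.ncard_le_ncard ?_ (M.ground_finite.finite_subsets.subset (fun X hX => hX.1))) h
    rintro B ⟨hBE, hB6, hCB, -⟩
    exact ⟨hBE, hB6, hCB⟩
  have h3 := hAk 3 t (fun C hC hCk => htri C hC hCk)
  have h4 := hAk 4 ((p + 6 - 4).choose 2) (fun C hC hCk => hsup 4 C hC hCk)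
  have h5 := hAk 5 ((p + 6 - 5).choose 1) (fun C hC hCk => hsup 5 C hC hCk)
  have h6 := hAk 6 ((p + 6 - 6).choose 0) (fun C hC hCk => hsup 6 C hC hCk)
  rw [Nat.choose_one_right] at h5
  rw [Nat.choose_zero_right, mul_one] at h6
  have hu := Set.ncard_le_ncard hcover (((hAfin 3).union (hAfin 4)).union (hAfin 5) |>.union (hAfin 6))
  have hu1 := Set.ncard_union_le (A 3 ∪ A 4 ∪ A 5) (A 6)
  have hu2 := Set.ncard_union_le (A 3 ∪ A 4) (A 5)
  have hu3 := Set.ncard_union_le (A 3) (A 4)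
  omega

end S2

end PercRepro
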